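import Summits.CriticalPhenomena.PercolationContinuityZ3.Theorems.PercNearOneGluingNoHeavyLowerTailSahiCombShapeCheckSorted

/-!
# The comb (tensor-Bernstein) hierarchy for Sahi's `E_k`, XV: computational cells of the typed shape laws on SORTED tuples —
# UNI(4)/ENDMIN(4)/ORDER-1(4) on the cube `{0,1}^3` and UNI(6)/ENDMIN(6)/ORDER-1(6) on the square `{0,1}^2` (`native_decide`)

Support file of the one-cut programme (crux `NoHeavyLowerTail`, stmt-CriticalPhenomena-4575; cell `prim-masterthm`, seat P5), COMPUTATIONAL
(`native_decide`).  The sorted digit scan `SahiComb.checkShapeCubeSorted` (`…SahiCombShapeCheckSorted`) on two cells beyond `…SahiCombShapeCellsNative`: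
`(n, m) = (4, 3)`: the `8 855` quadruple-multisets of the `20` increasing bitmasks of the cube (base `2^18`, ≈ 50 s) — the cell of prim-masterthm P3's
kernel theorem `sahiE4CombPositivityUpTo_three`, now with the SHAPE laws; `(6, 2)`: the `462` sextuple-multisets of the `6` increasing bitmasks of the
square (base `2^23`).

* `combShape_four_fin_three` — ENDMIN(4), ORDER-1(4), **UNI(4)** for every quadruple of increasing events of `2^{Fin 3}`;
* `combShape_six_fin_two` — ENDMIN(6), ORDER-1(6), **UNI(6)** for every sextuple of increasing events of `2^{Fin 2}`.
Outside the kernel these cells are tiny corners of the census (P5 report §7.4: `E_4` on `m ≤ 4` and `E_5` on `m ≤ 4` EXHAUSTIVE, `E_6` on `m ≤ 3`,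
≈ `7.8·10¹¹` coefficient lines, `0` violations).  No `sorry`; axioms standard plus `Lean.ofReduceBool`. [this work]
-/

namespace Summit.CriticalPhenomena.PercolationContinuityZ3.Theorems

open SahiComb SahiC3Cube NCopyCert OneCutCert

/-- The sorted shape scan passes on `(n, m) = (4, 3)` (8 855 quadruple-multisets, base `2^18`), compiled evaluation. [this work] -/
theorem SahiComb.checkShapeCubeSorted_four_three :
    checkShapeCubeSorted 18 3 4 (fun T => (krTB 18 5 3 T : ℤ)) (krTB 18 5 3 (fullN 3)) (maskN 18 (5 ^ 3)) = true := by
  native_decide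

/-- The sorted shape scan passes on `(n, m) = (6, 2)` (462 sextuple-multisets, base `2^23`), compiled evaluation. [this work] -/
theorem SahiComb.checkShapeCubeSorted_six_two :
    checkShapeCubeSorted 23 2 6 (fun T => (krTB 23 7 2 T : ℤ)) (krTB 23 7 2 (fullN 2)) (maskN 23 (7 ^ 2)) = true := by
  native_decide

/-- **ENDMIN(4), ORDER-1(4), UNI(4) on the cube `{0,1}^3`** (computational). [this work] -/
theorem combShape_four_fin_three (U : Fin 4 → Set (Set (Fin 3))) (hU : ∀ i, IsUpperSet (U i)) (e : Fin 3) (j : Fin 3 → ℕ) :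
    (∀ t, t ≤ 4 → min (combLine 4 U e j 0) (combLine 4 U e j 4) ≤ combLine 4 U e j t) ∧
      (combLine 4 U e j 0 ≤ combLine 4 U e j 1 ∧ combLine 4 U e j 4 ≤ combLine 4 U e j (4 - 1)) ∧
      ∃ mo, mo ≤ 4 ∧ MonotoneOn (combLine 4 U e j) (Set.Icc 0 mo) ∧ AntitoneOn (combLine 4 U e j) (Set.Icc mo 4) :=
  shape_of_checkShapeCubeSorted (σ := 18) (by norm_num) (by decide) (fun _ => rfl) checkShapeCubeSorted_four_three (by norm_num) U hU e j

/-- **ENDMIN(6), ORDER-1(6), UNI(6) on the square `{0,1}^2`** (computational). [this work] -/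
theorem combShape_six_fin_two (U : Fin 6 → Set (Set (Fin 2))) (hU : ∀ i, IsUpperSet (U i)) (e : Fin 2) (j : Fin 2 → ℕ) :
    (∀ t, t ≤ 6 → min (combLine 6 U e j 0) (combLine 6 U e j 6) ≤ combLine 6 U e j t) ∧
      (combLine 6 U e j 0 ≤ combLine 6 U e j 1 ∧ combLine 6 U e j 6 ≤ combLine 6 U e j (6 - 1)) ∧
      ∃ mo, mo ≤ 6 ∧ MonotoneOn (combLine 6 U e j) (Set.Icc 0 mo) ∧ AntitoneOn (combLine 6 U e j) (Set.Icc mo 6) :=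
  shape_of_checkShapeCubeSorted (σ := 23) (by norm_num) (by decide) (fun _ => rfl) checkShapeCubeSorted_six_two (by norm_num) U hU e j

end Summit.CriticalPhenomena.PercolationContinuityZ3.Theorems
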